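import Literature.Algebra.Homology.GroupCohomologyEquivariantGoodCover
import Literature.Algebra.Homology.GroupCohomologyFiniteIndexModuleFinite
import HarnessLib

/-!
# Brown's finiteness criterion from an equivariant good cover — finitely generated coefficients
# (stub `stub_moduleFinite_goodCover` of line `Sketch`)

Crux `HeckeEigenvalueField` (stmt-Langlands-13632).  This is the purely homological-algebra input
of the Borel–Serre finite-dimensionality of `H^q(Γ_U, A)` for congruence subgroups `Γ_U` with
coefficients a finitely generated representation over a Noetherian ring `k` (for `k` a field:
finite-dimensional): the verbatim twin of the tree's
`Literature.Algebra.Homology.finite_groupCohomology_of_free_equivariantGoodCover`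
(`Literature/Algebra/Homology/GroupCohomologyEquivariantGoodCover`) with
"`A` has finitely many elements ⇒ `Hⁿ(G, A)` finite" replaced by
"`A` finitely generated over a Noetherian `k` ⇒ `Hⁿ(G, A)` finitely generated over `k`".

Let a group `G` act on a CONTRACTIBLE space `X` and on an index set `ι`, and let
`𝔘 = (U_i)_{i ∈ ι}` be an open cover with `g U_i = U_{g i}` all of whose non-empty finite
intersections are contractible, the action on `ι` FREE and with finitely many `G`-orbits of
`p`-simplices of the nerve `N_p(𝔘)` for each `p`.  Then for every `A : Rep k G` finitely
generated over the Noetherian ring `k`, every `Hⁿ(G, A)` is finitely generated over `k`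
(`moduleFinite_groupCohomology_of_free_equivariantGoodCover`, universe-polymorphic;
`stub_moduleFinite_goodCover`, the registered `Type` instance).  The chain is the tree's, with
`Finite` replaced by `Module.Finite k`:

* `moduleFinite_groupCohomology_zero_of_shortExact`, `moduleFinite_groupCohomology_of_coresolution`
  — dimension shifting along a coresolution cut into short exact pieces
  (`H⁰(G, Z a) ↪ H⁰(G, W a)`, Mathlib `groupCohomology.mono_map_0_of_mono`, and the tree's
  `moduleFinite_groupCohomology_succ_of_shortExact`);
* `moduleFinite_groupCohomology_of_exact_sequence` — the same for an exact sequence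
  `0 → A → W 0 → W 1 → ⋯` (kernels as subrepresentations);
* `moduleFinite_groupCohomology_funRep_of_free` — `Hⁿ(G, Fun(Y, A))` for a free `G`-set `Y` with
  finitely many orbits, by `Fun(Y, A) ≅ Coind_1^G Fun(T, A)` (`funRepIsoCoind`) and Shapiro's
  lemma (Mathlib `groupCohomology.coindIso`);
* `moduleFinite_groupCohomology_of_invariantGoodCover` — the exact Čech coresolution
  `0 → A → Fun(N₀, A) → Fun(N₁, A) → ⋯` (`cechFunCoaug_injective`, `cechFunCoaug_exact`,
  `cechFunD_exact_succ`, Leray) in `Rep k G` (`cechRepD`);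
* `moduleFinite_groupCohomology_of_free_equivariantGoodCover` — the nerve is a free `G`-set with
  finitely many orbits in each degree (`Nerve.eq_one_of_smul_eq`, `Nerve.finite_orbitRelQuotient`,
  `bijective_smul_out`).

## References

* K. S. Brown, *Cohomology of Groups*, GTM 87 (1982), III §7, III (6.2), VII §4, VII (7.10),
  VIII §2 [Brown1982CohomologyGroups].
* A. Borel, J.-P. Serre, *Corners and arithmetic groups*, Comment. Math. Helv. 48 (1973), §11.1
  [BorelSerre1973].
-/

noncomputable section

set_option linter.dupNamespace false -- project-wide: `Summit.Langlands.Langlands` is the mandated namespace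

namespace Summit.Langlands.Langlands.Theorems.HeckeEigenvalueField.Res

open CategoryTheory groupCohomology
open Literature.Algebra.Homology
open Literature.AlgebraicTopology.SingularHomology
open Literature.AlgebraicTopology.SingularHomology.CechNerve
open scoped Pointwise

universe u

section Polymorphic

variable {k G : Type u} [CommRing k] [Group G] [IsNoetherianRing k]

/-! ### Dimension shifting along a coresolution -/

/-- **Degree `0`**: for a short exact sequence `0 → X₁ → X₂ → X₃ → 0` of representations over a
Noetherian ring `k`, `H⁰(G, X₁) ↪ H⁰(G, X₂)` (Mathlib `groupCohomology.mono_map_0_of_mono`), so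
`H⁰(G, X₁)` is finitely generated when `H⁰(G, X₂)` is (a submodule of a finitely generated module
over a Noetherian ring). [folklore] -/
theorem moduleFinite_groupCohomology_zero_of_shortExact {X : ShortComplex (Rep k G)}
    (hX : X.ShortExact) (h₂ : Module.Finite k (groupCohomology X.X₂ 0)) :
    Module.Finite k (groupCohomology X.X₁ 0) := by
  haveI := hX.mono_f
  haveI := h₂
  exact Module.Finite.of_injective (map (MonoidHom.id G) X.f 0).hom
    ((ModuleCat.mono_iff_injective (map (MonoidHom.id G) X.f 0)).1 inferInstance)

section Coresolution

variable (Z W : ℕ → Rep k G) (ι : ∀ a, Z a ⟶ W a) (π : ∀ a, W a ⟶ Z (a + 1))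
  (w : ∀ a, ι a ≫ π a = 0) (hex : ∀ a, (ShortComplex.mk (ι a) (π a) (w a)).ShortExact)

include hex in
/-- **Finite generation propagates along a coresolution.**  Let `Z 0 → W 0 → W 1 → ⋯` be a
coresolution in `Rep k G` (`k` Noetherian) presented by short exact pieces
`0 → Z a → W a → Z (a+1) → 0`.  If every `Hᵇ(G, W a)` is finitely generated over `k` then every
`Hᵇ(G, Z a)` is: induction on `b` for all `a` at once, using `H⁰(G, Z a) ↪ H⁰(G, W a)` and the
exact segments `Hᵇ(G, Z (a+1)) → Hᵇ⁺¹(G, Z a) → Hᵇ⁺¹(G, W a)`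
(`moduleFinite_groupCohomology_succ_of_shortExact`).  (Finiteness half of Brown's criterion,
VII (7.10), by dimension shifting instead of the spectral sequence.)
[cite: Brown1982CohomologyGroups, VII (7.10); III §7] -/
theorem moduleFinite_groupCohomology_of_coresolution
    (hW : ∀ a b, Module.Finite k (groupCohomology (W a) b)) :
    ∀ b a, Module.Finite k (groupCohomology (Z a) b) := by
  intro b
  induction b with
  | zero =>
    intro a
    exact moduleFinite_groupCohomology_zero_of_shortExact (hex a) (hW a 0)
  | succ b ih =>
    intro a
    exact moduleFinite_groupCohomology_succ_of_shortExact (hex a) b (ih (a + 1)) (hW a (b + 1))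

include hex in
/-- **Corollary (the abutment).**  Under the hypotheses of
`moduleFinite_groupCohomology_of_coresolution`, `Hᵇ(G, Z 0)` is finitely generated for every `b`.
[cite: Brown1982CohomologyGroups, VII (7.10)] -/
theorem moduleFinite_groupCohomology_of_coresolution_zero
    (hW : ∀ a b, Module.Finite k (groupCohomology (W a) b)) (b : ℕ) :
    Module.Finite k (groupCohomology (Z 0) b) :=
  moduleFinite_groupCohomology_of_coresolution Z W ι π w hex hW b 0

end Coresolution

/-- **Finitely generated group cohomology from an exact coresolution.**  Let
`0 → A —ε→ W 0 —d₀→ W 1 —d₁→ ⋯` be an exact sequence in `Rep k G` (`k` Noetherian; `ε` injective,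
`im ε = ker d₀`, `im d_a = ker d_{a+1}`).  If `Hᵇ(G, W a)` is finitely generated for all `a, b`,
then `Hᵇ(G, A)` is finitely generated for all `b` (cut into `0 → ker d_a → W a → ker d_{a+1} → 0`
and apply `moduleFinite_groupCohomology_of_coresolution`; `A ≅ ker d₀`).
[cite: Brown1982CohomologyGroups, VII (7.10); III §7] -/
theorem moduleFinite_groupCohomology_of_exact_sequence (A : Rep k G) (W : ℕ → Rep k G)
    (ε : A ⟶ W 0) (d : ∀ a, W a ⟶ W (a + 1))
    (hε : Function.Injective ε.hom) (h₀ : Function.Exact ε.hom (d 0).hom)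
    (hd : ∀ a, Function.Exact (d a).hom (d (a + 1)).hom)
    (hW : ∀ a b, Module.Finite k (groupCohomology (W a) b)) (b : ℕ) :
    Module.Finite k (groupCohomology A b) := by
  -- the kernels `Z a = ker d_a` as subrepresentations
  let K : ∀ a, Submodule k (W a) := fun a => LinearMap.ker (d a).hom.toLinearMap
  have hK : ∀ a g, K a ≤ (K a).comap ((W a).ρ g) := fun a g => ker_le_comap_of_hom (d a) g
  let Z : ℕ → Rep k G := fun a => Rep.subrepresentation (W a) (K a) (hK a)
  let ι : ∀ a, Z a ⟶ W a := fun a => Rep.subtype (W a) (K a) (hK a)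
  have hdd : ∀ a (x : W a), (d (a + 1)).hom ((d a).hom x) = 0 := fun a x =>
    (hd a ((d a).hom x)).2 ⟨x, rfl⟩
  -- the corestrictions `W a ↠ Z (a+1)` of `d_a`
  let π : ∀ a, W a ⟶ Z (a + 1) := fun a =>
    Rep.ofHom
      { toLinearMap := LinearMap.codRestrict (K (a + 1)) (d a).hom.toLinearMap fun x => by
          change (d (a + 1)).hom ((d a).hom x) = 0
          exact hdd a x
        isIntertwining' := fun g => by
          refine LinearMap.ext fun x => Subtype.ext ?_
          exact Rep.hom_comm_apply (d a) g x }
  have hπ : ∀ a (x : W a), ((π a).hom x : W (a + 1)) = (d a).hom x := fun a x => rfl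
  have w : ∀ a, ι a ≫ π a = 0 := fun a => by
    refine Rep.hom_ext (Representation.IntertwiningMap.ext (LinearMap.ext fun x => ?_))
    apply Subtype.ext
    change (d a).hom ((ι a).hom x) = 0
    exact x.2
  have hex : ∀ a, (ShortComplex.mk (ι a) (π a) (w a)).ShortExact := fun a => by
    refine shortExact_of_function_exact _ ?_ ?_ ?_
    · exact Subtype.val_injective
    · intro y
      obtain ⟨x, hx⟩ := (hd a (y : W (a + 1))).1 y.2
      exact ⟨x, Subtype.ext hx⟩
    · intro x
      change (π a).hom x = 0 ↔ x ∈ Set.range (ι a).hom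
      constructor
      · intro hx
        have hx' : (d a).hom x = 0 := by rw [← hπ, hx]; rfl
        exact ⟨⟨x, hx'⟩, rfl⟩
      · rintro ⟨z, rfl⟩
        exact Subtype.ext z.2
  have hZ : Module.Finite k (groupCohomology (Z 0) b) :=
    moduleFinite_groupCohomology_of_coresolution_zero Z W ι π w hex hW b
  -- `A ≅ Z 0`
  let φ : A ⟶ Z 0 :=
    Rep.ofHom
      { toLinearMap := LinearMap.codRestrict (K 0) ε.hom.toLinearMap fun x => by
          change (d 0).hom (ε.hom x) = 0
          exact (h₀ (ε.hom x)).2 ⟨x, rfl⟩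
        isIntertwining' := fun g => by
          refine LinearMap.ext fun x => Subtype.ext ?_
          exact Rep.hom_comm_apply ε g x }
  have hφ : Function.Bijective φ.hom := by
    constructor
    · intro x y hxy
      exact hε (congrArg Subtype.val hxy)
    · intro z
      obtain ⟨x, hx⟩ := (h₀ (z : W 0)).1 z.2
      exact ⟨x, Subtype.ext hx⟩
  haveI : IsIso ((forget (Rep k G)).map φ) := (isIso_iff_bijective _).2 hφ
  haveI : IsIso φ := isIso_of_reflects_iso φ (forget (Rep k G))
  exact (Module.Finite.equiv_iff
    ((groupCohomology.functor k G b).mapIso (asIso φ)).toLinearEquiv).2 hZ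

/-! ### Functions on a free `G`-set with finitely many orbits -/

/-- **`Hⁿ(G, Fun(Y, A))` is finitely generated for a free `G`-set `Y` with finitely many orbits
and `A` finitely generated over the Noetherian ring `k`**:
`Hⁿ(G, Fun(Y, A)) ≅ Hⁿ(G, Coind_1^G Fun(T, A)) ≅ Hⁿ(1, Fun(T, A))` (`funRepIsoCoind` and Shapiro's
lemma, Mathlib `groupCohomology.coindIso`), which is `0` for `n ≥ 1`
(`isZero_groupCohomology_succ_of_subsingleton`) and the invariants `Fun(T, A)¹ ⊆ Fun(T, A)`, a
finitely generated module for `T` finite, for `n = 0`.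
[cite: Brown1982CohomologyGroups, III (6.2) Shapiro's lemma] -/
theorem moduleFinite_groupCohomology_funRep_of_free (A : Rep.{u} k G) (Y : Type u)
    [MulAction G Y] {T : Type u} (t : T → Y)
    (hbij : Function.Bijective fun p : G × T => p.1 • t p.2) [Finite T] [Module.Finite k A]
    (n : ℕ) : Module.Finite k (groupCohomology (funRep A Y) n) := by
  have e := ((groupCohomology.functor k G n).mapIso (funRepIsoCoind A Y t hbij)).toLinearEquiv
  have h₁ : Module.Finite k (groupCohomology (orbitCoeff (k := k) A T) n) := by
    cases n with
    | zero =>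
      haveI : Module.Finite k (orbitCoeff (k := k) A T) :=
        inferInstanceAs (Module.Finite k (T → A))
      exact moduleFinite_groupCohomology_zero _
    | succ m =>
      haveI := ModuleCat.subsingleton_of_isZero
        (isZero_groupCohomology_succ_of_subsingleton (orbitCoeff (k := k) A T) m)
      infer_instance
  -- Shapiro's lemma `Hⁿ(G, Coind_1^G Fun(T, A)) ≅ Hⁿ(1, Fun(T, A))`
  have hc := (Module.Finite.equiv_iff
    (groupCohomology.coindIso (orbitCoeff (k := k) A T) n).toLinearEquiv).2 h₁
  exact (Module.Finite.equiv_iff e).2 hc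

/-! ### The finiteness criterion -/

/-- **Brown's finiteness criterion from an invariant good cover, finitely generated
coefficients.**  Let `G` act by homeomorphisms on a contractible space `X` covered by an invariant
family of open sets all of whose non-empty finite intersections are contractible.  If
`Hⁿ(G, Fun(N_p(𝔘), A))` is finitely generated over the Noetherian ring `k` for all `p, n`, then
`Hⁿ(G, A)` is finitely generated for all `n`: the Čech complex
`0 → A → Fun(N₀, A) → Fun(N₁, A) → ⋯` is an exact coresolution in `Rep k G`
(`cechFunCoaug_injective`, `cechFunCoaug_exact`, `cechFunD_exact_succ`), and dimension shifting
applies (`moduleFinite_groupCohomology_of_exact_sequence`).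
[cite: Brown1982CohomologyGroups, VII (7.10); VII §4] -/
theorem moduleFinite_groupCohomology_of_invariantGoodCover {X : Type u} [MulAction G X]
    {ι : Type u} [MulAction G ι] (U : ι → Set X) [IsInvariantFamily G U] (A : Rep.{u} k G)
    [TopologicalSpace X] [ContractibleSpace X]
    (hU : ∀ i, IsOpen (U i)) (hcov : (Set.univ : Set X) ⊆ ⋃ i, U i)
    (hgood : ∀ (p : ℕ) (J : Fin (p + 1) → ι), (cechSet U J).Nonempty →
      ContractibleSpace ↥(cechSet U J))
    (hW : ∀ p n, Module.Finite k (groupCohomology (funRep A (Nerve U p)) n)) (n : ℕ) :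
    Module.Finite k (groupCohomology A n) := by
  haveI : Nonempty X := inferInstance
  exact moduleFinite_groupCohomology_of_exact_sequence A (fun p => funRep A (Nerve U p))
    (funRepConst A (Nerve U 0)) (fun p => cechRepD U A p)
    (cechFunCoaug_injective (R := k) (M := A) (U := U) hcov)
    (cechFunCoaug_exact (R := k) (M := A) (U := U) hU hcov)
    (fun p => cechFunD_exact_succ (R := k) (M := A) (U := U) hU hcov hgood p) hW n

omit [IsNoetherianRing k] in
/-- **Brown's finiteness criterion from an equivariant good cover indexed by a free `G`-set with
finitely many orbits of simplices — finitely generated coefficients over a Noetherian ring.**  Let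
`G` act on a contractible space `X` covered by open sets `U_i` indexed by a FREE `G`-set `ι`, with
`g U_i = U_{g i}`, all non-empty finite intersections contractible, and finitely many `G`-orbits
of `p`-simplices of the nerve for each `p`.  Then `Hⁿ(G, A)` is finitely generated over `k` for
every representation `A` finitely generated over the Noetherian ring `k`: the nerve is a free
`G`-set with finitely many orbits in each degree, decomposed as `G × N_p/G ≃ N_p` by the section
`Quotient.out` (`bijective_smul_out`), so `Hⁿ(G, Fun(N_p, A))` is finitely generated
(`moduleFinite_groupCohomology_funRep_of_free`), and the exact Čech coresolution gives the claim
by dimension shifting (`moduleFinite_groupCohomology_of_invariantGoodCover`).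
[cite: Brown1982CohomologyGroups, VII (7.10); VIII §2] -/
theorem moduleFinite_groupCohomology_of_free_equivariantGoodCover
    {X : Type u} [TopologicalSpace X] [ContractibleSpace X]
    {ι : Type u} [MulAction G ι] [MulAction G X]
    (U : ι → Set X) (hUo : ∀ i, IsOpen (U i)) (hcov : Set.univ ⊆ ⋃ i, U i)
    (hgood : ∀ (p : ℕ) (J : Fin (p + 1) → ι),
      (cechSet U J).Nonempty → ContractibleSpace ↥(cechSet U J))
    (hUG : ∀ (g : G) (i : ι), (fun x : X => g • x) '' U i = U (g • i))
    (hfree : ∀ (g : G) (i : ι), g • i = i → g = 1)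
    (hfin : ∀ p : ℕ, ∃ S : Set (Fin (p + 1) → ι), S.Finite ∧
      ∀ J : Fin (p + 1) → ι, (cechSet U J).Nonempty → ∃ J₀ ∈ S, ∃ g : G, g • J₀ = J)
    [IsNoetherianRing k] (A : Rep.{u} k G) [Module.Finite k A] (n : ℕ) :
    Module.Finite k (groupCohomology A n) := by
  haveI : IsInvariantFamily G U := isInvariantFamily_of_image_eq U hUG
  refine moduleFinite_groupCohomology_of_invariantGoodCover U A hUo hcov hgood (fun p m => ?_) n
  obtain ⟨S, hS, hSN⟩ := hfin p
  haveI := Nerve.finite_orbitRelQuotient (G := G) U hS hSN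
  -- `bijective_smul_out` decomposes a free `G`-set as `N_p/G × G`; swap the factors.
  exact moduleFinite_groupCohomology_funRep_of_free A (Nerve U p)
    (fun a : MulAction.orbitRel.Quotient G (Nerve U p) => a.out)
    ((bijective_smul_out (Nerve.eq_one_of_smul_eq U hfree p)).comp Prod.swap_bijective) m

end Polymorphic

/-! ### The registered stub (all types in `Type`) -/

/-- **Stub M — Brown's finiteness criterion in Čech form, `Module.Finite` version** (twin of the
landed `finite_groupCohomology_of_free_equivariantGoodCover` with "finitely many elements" replaced by
"finitely generated over a Noetherian coefficient ring"): a group acting on a contractible space with an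
equivariant open good cover indexed by a free `G`-set with finitely many orbits of nerve simplices has
`Hⁿ(G, A)` finitely generated for `A` finitely generated. [cite: Brown1982CohomologyGroups, VII (7.10); VIII §2] -/
theorem stub_moduleFinite_goodCover :
    ∀ {X : Type} [TopologicalSpace X] [ContractibleSpace X]
      {G : Type} [Group G] {ι : Type} [MulAction G ι] [MulAction G X]
      (U : ι → Set X), (∀ i, IsOpen (U i)) → (Set.univ ⊆ ⋃ i, U i) →
      (∀ (p : ℕ) (J : Fin (p + 1) → ι),
        (Literature.AlgebraicTopology.SingularHomology.cechSet U J).Nonempty →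
          ContractibleSpace ↥(Literature.AlgebraicTopology.SingularHomology.cechSet U J)) →
      (∀ (g : G) (i : ι), (fun x : X => g • x) '' U i = U (g • i)) →
      (∀ (g : G) (i : ι), g • i = i → g = 1) →
      (∀ p : ℕ, ∃ S : Set (Fin (p + 1) → ι), S.Finite ∧
        ∀ J : Fin (p + 1) → ι,
          (Literature.AlgebraicTopology.SingularHomology.cechSet U J).Nonempty →
            ∃ J₀ ∈ S, ∃ g : G, g • J₀ = J) →
      ∀ {k : Type} [CommRing k] [IsNoetherianRing k] (A : Rep k G) [Module.Finite k A] (q : ℕ),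
        Module.Finite k (groupCohomology A q) := by
  intro X _ _ G _ ι _ _ U hUo hcov hgood hUG hfree hfin k _ _ A _ q
  exact moduleFinite_groupCohomology_of_free_equivariantGoodCover U hUo hcov hgood hUG hfree hfin A q

end Summit.Langlands.Langlands.Theorems.HeckeEigenvalueField.Res
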